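import Summits.ResolutionOfSingularities.ResolutionOfSingularities.Theorems.HilbertSamuelEliminationSigmaMaxModificationsStubCentreSeqPackage
import Literature.AlgebraicGeometry.Resolution.HilbertSamuelLocal
import Literature.AlgebraicGeometry.Resolution.ResolutionGlue
import Mathlib.AlgebraicGeometry.Morphisms.Proper
import Mathlib.AlgebraicGeometry.Noetherian
import HarnessLib

/-!
# Route `HilbertSamuelElimination`, crux `SigmaMaxModificationsCorridor3`
# (stmt-ResolutionOfSingularities-19249; child of `SigmaMaxModifications` stmt-…-18506),
# line `tame_wild` v3 (confined form) — a blow-up sequence of ONE CHART is a local `ν`-witness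

[OURS · L1 W4.2] Per-chart packaging for the CONFINED architecture (lead's H4F decision), in the
STRUCTURE-MAP form consumed by the two-chart merge `exists_localWitness_sup`
(`…Corridor3NuGluingMerge.lean`): for an open `U ⊆ Y` and a blow-up sequence `s : CentreSeq U` with
centres over the trace `U(ν) = U ∩ Y(ν)` of the stratum, `H^N` non-increasing along `s.comp` and `ν`
killed on `s.top`, the composite `s.comp ≫ U.ι : s.top → Y` is a local `ν`-witness over `U`: image in
`U`, proper locally over `U`, `s.top` locally Noetherian and reduced of dimension `≤ dim Y`, an
isomorphism over `U ∩ Zc` for every open `Zc ⊆ Y ∖ Y(ν)` (a blow-up is an isomorphism off its centre,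
landed `stub_centreSeq_package` p146611), dense opens inside `Y ∖ Y(ν)` pulled back to dense opens,
`H^N` non-increasing. In the confined transfer each chart `U_i ∋ y_i` carries such a sequence (from
THOR₄ on the embedded tower); the witnesses are merged pairwise and glued with the identity.
NOT a statement of any manuscript; no route-file import.

## Sources

* V. Cossart, U. Jannsen, S. Saito, LNM 2270 (2020), Def. 2.28, Def. 6.14, Rem. 6.24.
  [CossartJannsenSaito2020]
* The Stacks Project, Tag 02OS (blow-up off the centre), Tag 01LH. [StacksProject]
-/

set_option linter.dupNamespace false -- mandated namespace of this single-conjunct summit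

noncomputable section

open CategoryTheory AlgebraicGeometry TopologicalSpace Topology
open Literature.AlgebraicGeometry.Resolution Literature.RingTheory.HilbertSamuel
open Summit.ResolutionOfSingularities.ResolutionOfSingularities.Theorems.SigmaMaxModifications.Sketch

namespace Summit.ResolutionOfSingularities.ResolutionOfSingularities.Theorems.SigmaMaxModificationsCorridor3.TameWild

/-- The inclusion of an open restricted over itself is an isomorphism (a surjective open
immersion). [folklore] -/
theorem isIso_ι_morphismRestrict_of_le {Y : Scheme.{0}} (U W : Y.Opens) (hWU : W ≤ U) :
    IsIso (U.ι ∣_ W) := by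
  have hsurj : Function.Surjective (U.ι ∣_ W).base := by
    rintro ⟨x, hx⟩
    refine ⟨⟨⟨x, hWU hx⟩, hx⟩, Subtype.ext ?_⟩
    rw [morphismRestrict_base_coe]
    rfl
  haveI : Epi (U.ι ∣_ W).base := (TopCat.epi_iff_surjective _).mpr hsurj
  exact IsOpenImmersion.isIso _

/-- **A blow-up sequence of one chart, with centres over the trace of the stratum, is a local
`ν`-witness over that chart** (structure-map form). Hypotheses: `Y` locally Noetherian and reduced,
`dim Y ≤ d`, `dim Y ≤ N`; `Zc ⊆ Y ∖ Y(ν)` open; `U ⊆ Y` open; `s : CentreSeq U` with centres over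
`U(ν)`, `H^N` non-increasing along `s.comp`, `ν ∉ Σ_{s.top}(N)`. Conclusion: the ten clauses of a local
witness over `U` for `s.comp ≫ U.ι`. [cite: CossartJannsenSaito2020, Def. 6.14, Rem. 6.24]
[cite: StacksProject, Tag 02OS] -/
theorem localWitness_of_centreSeq_chart (Y : Scheme.{0}) [IsLocallyNoetherian Y] [IsReduced Y]
    (N d : ℕ) (ν : ℕ → ℕ) (hdimd : topologicalKrullDim Y ≤ (d : WithBot ℕ∞))
    (hdimN : topologicalKrullDim Y ≤ (N : WithBot ℕ∞)) (Zc : Y.Opens)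
    (hZc : (Zc : Set Y) ⊆ (Scheme.hsStratum Y N ν)ᶜ) (U : Y.Opens) (s : CentreSeq (U : Scheme.{0}))
    (hover : s.CentresOver (Scheme.hsStratum (U : Scheme.{0}) N ν))
    (hmono : ∀ x' : s.top,
      Scheme.hsFun s.top N x' ≤ Scheme.hsFun (U : Scheme.{0}) N (s.comp.base x'))
    (hkill : ν ∉ Scheme.hsValues s.top N) :
    IsLocallyNoetherian s.top ∧ (∀ x' : s.top, (s.comp ≫ U.ι) x' ∈ U) ∧
      (∀ y ∈ U, ∃ W : Y.Opens, y ∈ W ∧ IsProper ((s.comp ≫ U.ι) ∣_ W)) ∧ IsReduced s.top ∧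
      topologicalKrullDim s.top ≤ (d : WithBot ℕ∞) ∧ topologicalKrullDim s.top ≤ (N : WithBot ℕ∞) ∧
      IsIso ((s.comp ≫ U.ι) ∣_ (U ⊓ Zc)) ∧
      (∀ V : Y.Opens, Dense (V : Set Y) → (V : Set Y) ⊆ (Scheme.hsStratum Y N ν)ᶜ →
        Dense (((s.comp ≫ U.ι) ⁻¹ᵁ V : s.top.Opens) : Set s.top)) ∧
      (∀ x' : s.top, Scheme.hsFun s.top N x' ≤ Scheme.hsFun Y N ((s.comp ≫ U.ι) x')) ∧
      ν ∉ Scheme.hsValues s.top N := by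
  haveI : IsReduced (U : Scheme.{0}) := isReduced_of_isOpenImmersion U.ι
  -- the stratum of `U` is the trace of the stratum of `Y`
  have hstr : ∀ u : (U : Scheme.{0}), u ∈ Scheme.hsStratum (U : Scheme.{0}) N ν ↔
      U.ι.base u ∈ Scheme.hsStratum Y N ν := fun u => by
    rw [Scheme.mem_hsStratum_iff, Scheme.mem_hsStratum_iff, Scheme.hsFun_opens]
  have hdimU : topologicalKrullDim (U : Scheme.{0}) ≤ topologicalKrullDim Y :=
    U.ι.isOpenEmbedding.isInducing.topologicalKrullDim_le
  -- package the sequence on `U` (a blow-up is an isomorphism off its centre)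
  obtain ⟨hprop, hsred, hsdimd, hiso, hdense⟩ :=
    stub_centreSeq_package (U : Scheme.{0}) d (hdimU.trans hdimd)
      (Scheme.hsStratum (U : Scheme.{0}) N ν) s hover
  have hsdimN : topologicalKrullDim s.top ≤ (N : WithBot ℕ∞) :=
    topologicalKrullDim_top_le s (hdimU.trans hdimN)
  haveI := hprop
  haveI : IsLocallyNoetherian s.top := LocallyOfFiniteType.isLocallyNoetherian s.comp
  have hcomp : ∀ W : Y.Opens, (s.comp ≫ U.ι) ∣_ W = (s.comp ∣_ (U.ι ⁻¹ᵁ W)) ≫ (U.ι ∣_ W) :=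
    fun W => morphismRestrict_comp s.comp U.ι W
  refine ⟨inferInstance, fun x' => ?_, fun y hy => ⟨U, hy, ?_⟩, hsred, hsdimd, hsdimN, ?_, ?_, ?_,
    hkill⟩
  · -- image in `U`
    rw [Scheme.Hom.comp_apply, Scheme.Opens.ι_apply]
    exact (s.comp x').2
  · -- proper over `U`: `s.comp` restricted, followed by the isomorphism `U.ι ∣ U`
    rw [hcomp U]
    have hP1 : IsProper (s.comp ∣_ (U.ι ⁻¹ᵁ U)) := IsZariskiLocalAtTarget.restrict hprop _
    have hP2 : IsProper (U.ι ∣_ U) :=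
      @MorphismProperty.of_isIso _ _ @IsProper _ _ _ _ (U.ι ∣_ U)
        (isIso_ι_morphismRestrict_of_le U U le_rfl)
    exact MorphismProperty.comp_mem @IsProper _ _ hP1 hP2
  · -- isomorphism over `U ∩ Zc`
    rw [hcomp (U ⊓ Zc)]
    have h1 : IsIso (s.comp ∣_ (U.ι ⁻¹ᵁ (U ⊓ Zc))) := by
      refine hiso _ fun u hu hu' => ?_
      exact hZc hu.2 ((hstr u).mp hu')
    have h2 : IsIso (U.ι ∣_ (U ⊓ Zc)) := isIso_ι_morphismRestrict_of_le U (U ⊓ Zc) inf_le_left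
    exact @IsIso.comp_isIso _ _ _ _ _ _ _ h1 h2
  · -- dense opens of `Y` inside `Y ∖ Y(ν)` restrict to dense opens of `U` inside `U ∖ U(ν)`
    intro V hVd hV
    have h := hdense (U.ι ⁻¹ᵁ V) (hVd.preimage U.2.isOpenMap_subtype_val) fun u hu hu' =>
      hV hu ((hstr u).mp hu')
    exact h
  · -- `H^N_{U} = H^N_Y|_{U}`
    intro x'
    rw [Scheme.Hom.comp_apply, ← Scheme.hsFun_opens U N (s.comp.base x')]
    exact hmono x'

/-! ## The same over an arbitrary open immersion (charts given as open immersions, e.g. the top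
of a restricted blow-up sequence `CentreSeq.restrictι`) -/

/-- An open immersion restricted over an open inside its range is an isomorphism. [folklore] -/
theorem isIso_morphismRestrict_of_le_opensRange {V Y : Scheme.{0}} (j : V ⟶ Y) [IsOpenImmersion j]
    (W : Y.Opens) (hW : W ≤ j.opensRange) : IsIso (j ∣_ W) := by
  have hsurj : Function.Surjective (j ∣_ W).base := by
    rintro ⟨x, hx⟩
    obtain ⟨v, rfl⟩ := (Scheme.Hom.mem_opensRange.mp (hW hx))
    exact ⟨⟨v, hx⟩, Subtype.ext (morphismRestrict_base_coe j W ⟨v, hx⟩)⟩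
  haveI : Epi (j ∣_ W).base := (TopCat.epi_iff_surjective _).mpr hsurj
  exact IsOpenImmersion.isIso _

/-- **A blow-up sequence of a chart given by an OPEN IMMERSION `j : V → Y`, with centres over the
trace of the stratum, is a local `ν`-witness over `j(V)`** (structure-map form; the variant of
`localWitness_of_centreSeq_chart` needed when the chart is the top of a restricted sequence).
[cite: CossartJannsenSaito2020, Def. 6.14, Rem. 6.24] [cite: StacksProject, Tag 02OS] -/
theorem localWitness_of_centreSeq_openImmersion (Y : Scheme.{0}) [IsLocallyNoetherian Y]
    [IsReduced Y] (N d : ℕ) (ν : ℕ → ℕ) (hdimd : topologicalKrullDim Y ≤ (d : WithBot ℕ∞))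
    (hdimN : topologicalKrullDim Y ≤ (N : WithBot ℕ∞)) (Zc : Y.Opens)
    (hZc : (Zc : Set Y) ⊆ (Scheme.hsStratum Y N ν)ᶜ) (V : Scheme.{0}) (j : V ⟶ Y)
    [IsOpenImmersion j] (s : CentreSeq V) (hover : s.CentresOver (Scheme.hsStratum V N ν))
    (hmono : ∀ x' : s.top, Scheme.hsFun s.top N x' ≤ Scheme.hsFun V N (s.comp.base x'))
    (hkill : ν ∉ Scheme.hsValues s.top N) :
    IsLocallyNoetherian s.top ∧ (∀ x' : s.top, (s.comp ≫ j) x' ∈ j.opensRange) ∧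
      (∀ y ∈ j.opensRange, ∃ W : Y.Opens, y ∈ W ∧ IsProper ((s.comp ≫ j) ∣_ W)) ∧
      IsReduced s.top ∧
      topologicalKrullDim s.top ≤ (d : WithBot ℕ∞) ∧ topologicalKrullDim s.top ≤ (N : WithBot ℕ∞) ∧
      IsIso ((s.comp ≫ j) ∣_ (j.opensRange ⊓ Zc)) ∧
      (∀ W : Y.Opens, Dense (W : Set Y) → (W : Set Y) ⊆ (Scheme.hsStratum Y N ν)ᶜ →
        Dense (((s.comp ≫ j) ⁻¹ᵁ W : s.top.Opens) : Set s.top)) ∧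
      (∀ x' : s.top, Scheme.hsFun s.top N x' ≤ Scheme.hsFun Y N ((s.comp ≫ j) x')) ∧
      ν ∉ Scheme.hsValues s.top N := by
  haveI : IsReduced V := isReduced_of_isOpenImmersion j
  haveI : IsLocallyNoetherian V := isLocallyNoetherian_of_isOpenImmersion j
  -- the stratum of `V` is the trace of the stratum of `Y`
  have hstr : ∀ v : V, v ∈ Scheme.hsStratum V N ν ↔ j.base v ∈ Scheme.hsStratum Y N ν := fun v => by
    rw [Scheme.mem_hsStratum_iff, Scheme.mem_hsStratum_iff, Scheme.hsFun_eq_of_isOpenImmersion j N v]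
  have hdimV : topologicalKrullDim V ≤ topologicalKrullDim Y :=
    j.isOpenEmbedding.isInducing.topologicalKrullDim_le
  obtain ⟨hprop, hsred, hsdimd, hiso, hdense⟩ :=
    stub_centreSeq_package V d (hdimV.trans hdimd) (Scheme.hsStratum V N ν) s hover
  have hsdimN : topologicalKrullDim s.top ≤ (N : WithBot ℕ∞) :=
    topologicalKrullDim_top_le s (hdimV.trans hdimN)
  haveI := hprop
  haveI : IsLocallyNoetherian s.top := LocallyOfFiniteType.isLocallyNoetherian s.comp
  have hcomp : ∀ W : Y.Opens, (s.comp ≫ j) ∣_ W = (s.comp ∣_ (j ⁻¹ᵁ W)) ≫ (j ∣_ W) :=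
    fun W => morphismRestrict_comp s.comp j W
  refine ⟨inferInstance, fun x' => ?_, fun y hy => ⟨j.opensRange, hy, ?_⟩, hsred, hsdimd, hsdimN,
    ?_, ?_, ?_, hkill⟩
  · rw [Scheme.Hom.comp_apply]
    exact Scheme.Hom.mem_opensRange.mpr ⟨_, rfl⟩
  · rw [hcomp j.opensRange]
    have hP1 : IsProper (s.comp ∣_ (j ⁻¹ᵁ j.opensRange)) := IsZariskiLocalAtTarget.restrict hprop _
    have hP2 : IsProper (j ∣_ j.opensRange) :=
      @MorphismProperty.of_isIso _ _ @IsProper _ _ _ _ (j ∣_ j.opensRange)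
        (isIso_morphismRestrict_of_le_opensRange j j.opensRange le_rfl)
    exact MorphismProperty.comp_mem @IsProper _ _ hP1 hP2
  · rw [hcomp (j.opensRange ⊓ Zc)]
    have h1 : IsIso (s.comp ∣_ (j ⁻¹ᵁ (j.opensRange ⊓ Zc))) := by
      refine hiso _ fun v hv hv' => ?_
      exact hZc hv.2 ((hstr v).mp hv')
    have h2 : IsIso (j ∣_ (j.opensRange ⊓ Zc)) :=
      isIso_morphismRestrict_of_le_opensRange j _ inf_le_left
    exact @IsIso.comp_isIso _ _ _ _ _ _ _ h1 h2
  · intro W hWd hW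
    exact hdense (j ⁻¹ᵁ W) (hWd.preimage j.isOpenEmbedding.isOpenMap) fun v hv hv' =>
      hW hv ((hstr v).mp hv')
  · intro x'
    rw [Scheme.Hom.comp_apply, ← Scheme.hsFun_eq_of_isOpenImmersion j N (s.comp.base x')]
    exact hmono x'

end Summit.ResolutionOfSingularities.ResolutionOfSingularities.Theorems.SigmaMaxModificationsCorridor3.TameWild

end
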